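import Summits.Ventures.AbcSig.Rows.TemplateB
import Summits.Ventures.AbcSig.Recipes.EisPackage

/-!
# Venture AbcSig — EXTENDED-EXCLUSION twin of `Rows/TemplateB.lean` (GENERATED by gen/mkxtemplates.py)

HONEST FRAMING. Template file of a COMPUTATION cell (`pub-abcsig`); no claim on ABC or any summit. Each theorem
`x<name>` below is the theorem `<name>` of `Rows/TemplateB.lean` with ONE change: the per-orbit alternative of every level
hypothesis reads `o.Eliminated bs04Allowed n ∨ (M.Excludes N o fam ∨ M.ExcludesStd N o n)` instead of
`o.Eliminated bs04Allowed n ∨ M.Excludes N o fam`, where `M.ExcludesStd N o n` (`Recipes/EisPackage.lean`) says that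
no STANDING datum with exponent `n` has its mod-`n` representation arising from a newform matching `o` — the shape
in which the cell's module-M6 (Eisenstein congruence) certificates are discharged by the kernel
(`NewformModel.excludesStd_of_m6`, given the cited `EisPackage` and the computed `Refines`). Proofs are the originals
verbatim up to the renamed callee; the final step is `xno_solution_in_case`.
-/

namespace Summit.Ventures.AbcSig


/-- The common final step, EXTENDED per-orbit alternative: a datum `S` in case `κ` at level `N` with complete data
and, per orbit, a kernel certificate, a cited family exclusion, or a standing-datum exclusion for the exponent `S.n`
(`NewformModel.ExcludesStd`, e.g. from an M6 certificate via `excludesStd_of_m6`) contradicts `BS04Package`. -/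
theorem xno_solution_in_case (M : NewformModel) (hP : M.BS04Package) (S : FreyDatum) (κ : FreyCase) (N : ℕ)
    (hA : 0 < S.A) (hB : 0 < S.B) (hC : 0 < S.C) (hsq : Squarefree S.C) (hn : S.n.Prime) (h7 : 7 ≤ S.n)
    (hndvd : ¬ S.n ∣ S.A * S.B * S.C) (hfree : ∀ q : ℕ, q.Prime → ¬ q ^ S.n ∣ S.A ∧ ¬ q ^ S.n ∣ S.B)
    (hsol : IsPrimitiveSolution S.A S.B S.C S.n S.a S.b S.c) (hab1 : S.a * S.b ≠ 1) (hab2 : S.a * S.b ≠ -1)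
    (hcase : κ.Holds S.A S.B S.C S.n S.a S.b S.c) (hN : bs04Level κ S.A S.B S.C S.n = N)
    {orbs : List OrbitData} (hD : M.DataComplete N orbs) (fam : FreyDatum → Prop) (hfam : fam S)
    (hS : ∀ o ∈ orbs, (∀ e ∈ o.coeffs, e.ell.Prime ∧ e.ell ≠ 2 ∧ ¬ e.ell ∣ N) ∧
      (o.Eliminated bs04Allowed S.n ∨ (M.Excludes N o fam ∨ M.ExcludesStd N o S.n))) : False := by
  obtain ⟨hlev, hmod⟩ := hP S κ hA hB hC hsq hn h7 hndvd hfree hsol hab1 hab2 hcase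
  obtain ⟨f, hf⟩ := hlev N hN
  obtain ⟨o, ho, hfo⟩ := hD f
  obtain ⟨hgood, h⟩ := hS o ho
  rcases h with helim | hex | hstd
  · exact M.not_arisesMod_of_eliminated f o hfo S.n bs04Allowed helim hgood (hmod N f hf)
  · exact hex S hfam f hfo hf
  · exact hstd S κ ⟨hA, hB, hC, hsq, hn, h7, hndvd, hfree, hsol, hab1, hab2, hcase⟩ rfl f hfo hf

/-- **Branch (v₇): `2⁷ ∣ B yⁿ`** (i.e. `ord₂ B ≥ 7`, or `y` even with `n ≥ 7`). Level `N = bs04Level v₇ 1 B 1 n`. -/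
theorem xbranch_v7 (B : ℕ) (hB : 0 < B) (M : NewformModel) (hP : M.BS04Package) (n : ℕ) (hn : n.Prime)
    (h7 : 7 ≤ n) (hnB : ¬ n ∣ B) (hfreeB : ∀ q : ℕ, q.Prime → ¬ q ^ n ∣ B) (N : ℕ)
    (hN : bs04Level .v₇ 1 B 1 n = N) (P : ℤ → ℤ → Prop) {orbs : List OrbitData}
    (hD : M.DataComplete N orbs)
    (hS : ∀ o ∈ orbs, (∀ e ∈ o.coeffs, e.ell.Prime ∧ e.ell ≠ 2 ∧ ¬ e.ell ∣ N) ∧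
      (o.Eliminated bs04Allowed n ∨ (M.Excludes N o (famB B n P) ∨ M.ExcludesStd N o n)))
    (x y z : ℤ) (hPxy : P x y) (hv : (2 : ℤ) ^ 7 ∣ B * y ^ n) (hxy1 : x * y ≠ 1)
    (hxy2 : x * y ≠ -1) :
    ¬ IsPrimitiveSolution 1 B 1 n x y z := by
  intro hsol
  have h2 : 2 ∣ (B : ℤ) * y := two_dvd_By_of_pow ((dvd_pow_self 2 (by norm_num)).trans hv)
  have hz := odd_z_of_two_dvd_By hsol h2
  obtain ⟨z', hz'sgn, hz'⟩ := exists_sign_sub_four_dvd_int z 1 hz (by omega)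
  have hsol' : IsPrimitiveSolution 1 B 1 n x y z' := hsol.of_sign hz'sgn
  have hcase : FreyCase.Holds .v₇ 1 B 1 n x y z' := ⟨hv, by simpa using hz'⟩
  exact xno_solution_in_case M hP ⟨1, B, 1, n, x, y, z'⟩ .v₇ N one_pos hB one_pos squarefree_one hn h7
    (by simpa using hnB) (nthPowerFree_one B n (by omega) hfreeB) hsol' hxy1 hxy2 hcase hN hD
    (famB B n P) ⟨Or.inl ⟨rfl, rfl, hPxy⟩, rfl, rfl⟩ hS

/-- **Branch (v₆): `ord₂(B yⁿ) = 6`** (`ord₂ B = 6`, `y` odd). Level `N = bs04Level v₆ 1 B 1 n`. -/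
theorem xbranch_v6 (B : ℕ) (hB : 0 < B) (M : NewformModel) (hP : M.BS04Package) (n : ℕ) (hn : n.Prime)
    (h7 : 7 ≤ n) (hnB : ¬ n ∣ B) (hfreeB : ∀ q : ℕ, q.Prime → ¬ q ^ n ∣ B) (N : ℕ)
    (hN : bs04Level .v₆ 1 B 1 n = N) (P : ℤ → ℤ → Prop) {orbs : List OrbitData}
    (hD : M.DataComplete N orbs)
    (hS : ∀ o ∈ orbs, (∀ e ∈ o.coeffs, e.ell.Prime ∧ e.ell ≠ 2 ∧ ¬ e.ell ∣ N) ∧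
      (o.Eliminated bs04Allowed n ∨ (M.Excludes N o (famB B n P) ∨ M.ExcludesStd N o n)))
    (x y z : ℤ) (hPxy : P x y) (hv : OrdTwoEq (B * y ^ n) 6) (hxy1 : x * y ≠ 1)
    (hxy2 : x * y ≠ -1) :
    ¬ IsPrimitiveSolution 1 B 1 n x y z := by
  intro hsol
  have h2 : 2 ∣ (B : ℤ) * y := two_dvd_By_of_pow ((dvd_pow_self 2 (by norm_num)).trans hv.1)
  have hz := odd_z_of_two_dvd_By hsol h2
  obtain ⟨z', hz'sgn, hz'⟩ := exists_sign_sub_four_dvd_int z 1 hz (by omega)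
  have hsol' : IsPrimitiveSolution 1 B 1 n x y z' := hsol.of_sign hz'sgn
  have hcase : FreyCase.Holds .v₆ 1 B 1 n x y z' := ⟨hv, by simpa using hz'⟩
  exact xno_solution_in_case M hP ⟨1, B, 1, n, x, y, z'⟩ .v₆ N one_pos hB one_pos squarefree_one hn h7
    (by simpa using hnB) (nthPowerFree_one B n (by omega) hfreeB) hsol' hxy1 hxy2 hcase hN hD
    (famB B n P) ⟨Or.inl ⟨rfl, rfl, hPxy⟩, rfl, rfl⟩ hS

/-- **Branch (iv), `ord₂ B ∈ {4, 5}`, `xy` odd.** Level `N = bs04Level iv₄₅ 1 B 1 n`. -/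
theorem xbranch_iv45 (B : ℕ) (hB : 0 < B) (M : NewformModel) (hP : M.BS04Package) (n : ℕ) (hn : n.Prime)
    (h7 : 7 ≤ n) (hnB : ¬ n ∣ B) (hfreeB : ∀ q : ℕ, q.Prime → ¬ q ^ n ∣ B) (N : ℕ)
    (hN : bs04Level .iv₄₅ 1 B 1 n = N) (P : ℤ → ℤ → Prop) {orbs : List OrbitData}
    (hD : M.DataComplete N orbs)
    (hS : ∀ o ∈ orbs, (∀ e ∈ o.coeffs, e.ell.Prime ∧ e.ell ≠ 2 ∧ ¬ e.ell ∣ N) ∧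
      (o.Eliminated bs04Allowed n ∨ (M.Excludes N o (famB B n P) ∨ M.ExcludesStd N o n)))
    (x y z : ℤ) (hPxy : P x y) (hB45 : OrdTwoEq B 4 ∨ OrdTwoEq B 5) (hxy : ¬ 2 ∣ x * y)
    (h1 : x * y ≠ 1) (h2 : x * y ≠ -1) :
    ¬ IsPrimitiveSolution 1 B 1 n x y z := by
  intro hsol
  have hB2 : 2 ∣ (B : ℤ) := by
    rcases hB45 with h | h
    · exact (dvd_pow_self 2 (by norm_num)).trans h.1
    · exact (dvd_pow_self 2 (by norm_num)).trans h.1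
  have hz := odd_z_of_two_dvd_By hsol (hB2.mul_right y)
  obtain ⟨z', hz'sgn, hz'⟩ := exists_sign_sub_four_dvd_int z 1 hz (by omega)
  have hsol' : IsPrimitiveSolution 1 B 1 n x y z' := hsol.of_sign hz'sgn
  have hcase : FreyCase.Holds .iv₄₅ 1 B 1 n x y z' := ⟨hxy, hB45, by simpa using hz'⟩
  exact xno_solution_in_case M hP ⟨1, B, 1, n, x, y, z'⟩ .iv₄₅ N one_pos hB one_pos squarefree_one hn h7
    (by simpa using hnB) (nthPowerFree_one B n (by omega) hfreeB) hsol' h1 h2 hcase hN hD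
    (famB B n P) ⟨Or.inl ⟨rfl, rfl, hPxy⟩, rfl, rfl⟩ hS

/-- **Branch (iv), `ord₂ B = 3`, `xy` odd.** Level `N = bs04Level iv₃ 1 B 1 n`. -/
theorem xbranch_iv3 (B : ℕ) (hB : 0 < B) (M : NewformModel) (hP : M.BS04Package) (n : ℕ) (hn : n.Prime)
    (h7 : 7 ≤ n) (hnB : ¬ n ∣ B) (hfreeB : ∀ q : ℕ, q.Prime → ¬ q ^ n ∣ B) (N : ℕ)
    (hN : bs04Level .iv₃ 1 B 1 n = N) (P : ℤ → ℤ → Prop) {orbs : List OrbitData}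
    (hD : M.DataComplete N orbs)
    (hS : ∀ o ∈ orbs, (∀ e ∈ o.coeffs, e.ell.Prime ∧ e.ell ≠ 2 ∧ ¬ e.ell ∣ N) ∧
      (o.Eliminated bs04Allowed n ∨ (M.Excludes N o (famB B n P) ∨ M.ExcludesStd N o n)))
    (x y z : ℤ) (hPxy : P x y) (hB3 : OrdTwoEq B 3) (hxy : ¬ 2 ∣ x * y)
    (h1 : x * y ≠ 1) (h2 : x * y ≠ -1) :
    ¬ IsPrimitiveSolution 1 B 1 n x y z := by
  intro hsol
  have hB2 : 2 ∣ (B : ℤ) := (dvd_pow_self 2 (by norm_num)).trans hB3.1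
  have hz := odd_z_of_two_dvd_By hsol (hB2.mul_right y)
  obtain ⟨z', hz'sgn, hz'⟩ := exists_sign_sub_four_dvd_int z 1 hz (by omega)
  have hsol' : IsPrimitiveSolution 1 B 1 n x y z' := hsol.of_sign hz'sgn
  have hcase : FreyCase.Holds .iv₃ 1 B 1 n x y z' := ⟨hxy, hB3, by simpa using hz'⟩
  exact xno_solution_in_case M hP ⟨1, B, 1, n, x, y, z'⟩ .iv₃ N one_pos hB one_pos squarefree_one hn h7
    (by simpa using hnB) (nthPowerFree_one B n (by omega) hfreeB) hsol' h1 h2 hcase hN hD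
    (famB B n P) ⟨Or.inl ⟨rfl, rfl, hPxy⟩, rfl, rfl⟩ hS

/-- **Branch (ii), `ord₂ B = 1`, `xy` odd.** Level `N = bs04Level iiB 1 B 1 n`. -/
theorem xbranch_iiB (B : ℕ) (hB : 0 < B) (M : NewformModel) (hP : M.BS04Package) (n : ℕ) (hn : n.Prime)
    (h7 : 7 ≤ n) (hnB : ¬ n ∣ B) (hfreeB : ∀ q : ℕ, q.Prime → ¬ q ^ n ∣ B) (N : ℕ)
    (hN : bs04Level .iiB 1 B 1 n = N) (P : ℤ → ℤ → Prop) {orbs : List OrbitData}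
    (hD : M.DataComplete N orbs)
    (hS : ∀ o ∈ orbs, (∀ e ∈ o.coeffs, e.ell.Prime ∧ e.ell ≠ 2 ∧ ¬ e.ell ∣ N) ∧
      (o.Eliminated bs04Allowed n ∨ (M.Excludes N o (famB B n P) ∨ M.ExcludesStd N o n)))
    (x y z : ℤ) (hPxy : P x y) (hB1 : OrdTwoEq B 1) (hxy : ¬ 2 ∣ x * y)
    (h1 : x * y ≠ 1) (h2 : x * y ≠ -1) :
    ¬ IsPrimitiveSolution 1 B 1 n x y z := by
  intro hsol
  have hcase : FreyCase.Holds .iiB 1 B 1 n x y z := ⟨hxy, hB1⟩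
  exact xno_solution_in_case M hP ⟨1, B, 1, n, x, y, z⟩ .iiB N one_pos hB one_pos squarefree_one hn h7
    (by simpa using hnB) (nthPowerFree_one B n (by omega) hfreeB) hsol h1 h2 hcase hN hD
    (famB B n P) ⟨Or.inl ⟨rfl, rfl, hPxy⟩, rfl, rfl⟩ hS

/-- **Branch (iii), `ord₂ B = 2`, `xy` odd:** after fixing the sign of `z` (`z ≡ −yB/4 (mod 4)`), the datum is in
case (iii₁) (`y ≡ −B/4 (mod 4)`, level `N₁`) or (iii₂) (`y ≡ B/4 (mod 4)`, level `N₂`); both levels are needed. -/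
theorem xbranch_iii (B : ℕ) (hB : 0 < B) (M : NewformModel) (hP : M.BS04Package) (n : ℕ) (hn : n.Prime)
    (h7 : 7 ≤ n) (hnB : ¬ n ∣ B) (hfreeB : ∀ q : ℕ, q.Prime → ¬ q ^ n ∣ B) (N₁ N₂ : ℕ)
    (hN₁ : bs04Level .iii₁ 1 B 1 n = N₁) (hN₂ : bs04Level .iii₂ 1 B 1 n = N₂) (P : ℤ → ℤ → Prop)
    {orbs₁ orbs₂ : List OrbitData} (hD₁ : M.DataComplete N₁ orbs₁) (hD₂ : M.DataComplete N₂ orbs₂)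
    (hS₁ : ∀ o ∈ orbs₁, (∀ e ∈ o.coeffs, e.ell.Prime ∧ e.ell ≠ 2 ∧ ¬ e.ell ∣ N₁) ∧
      (o.Eliminated bs04Allowed n ∨ (M.Excludes N₁ o (famB B n P) ∨ M.ExcludesStd N₁ o n)))
    (hS₂ : ∀ o ∈ orbs₂, (∀ e ∈ o.coeffs, e.ell.Prime ∧ e.ell ≠ 2 ∧ ¬ e.ell ∣ N₂) ∧
      (o.Eliminated bs04Allowed n ∨ (M.Excludes N₂ o (famB B n P) ∨ M.ExcludesStd N₂ o n)))
    (x y z : ℤ) (hPxy : P x y) (hB2 : OrdTwoEq B 2) (hxy : ¬ 2 ∣ x * y)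
    (h1 : x * y ≠ 1) (h2 : x * y ≠ -1) :
    ¬ IsPrimitiveSolution 1 B 1 n x y z := by
  intro hsol
  have hy : ¬ 2 ∣ y := fun h => hxy (Dvd.dvd.mul_left h x)
  obtain ⟨h4B, h8B⟩ := hB2
  have h4 : (4 : ℤ) ∣ (B : ℤ) := by simpa using h4B
  have h8 : ¬ (8 : ℤ) ∣ (B : ℤ) := by simpa using h8B
  have h4n : 4 ∣ B := by exact_mod_cast h4
  have hBq : (B : ℤ) = 4 * ((B / 4 : ℕ) : ℤ) := by
    have : B = 4 * (B / 4) := (Nat.mul_div_cancel' h4n).symm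
    exact_mod_cast this
  have hqodd : ¬ 2 ∣ ((B / 4 : ℕ) : ℤ) := by
    intro h
    apply h8
    obtain ⟨k, hk⟩ := h
    exact ⟨k, by rw [hBq, hk]; ring⟩
  have h2By : 2 ∣ (B : ℤ) * y := by
    rw [hBq]
    exact ⟨2 * ((B / 4 : ℕ) : ℤ) * y, by ring⟩
  have hz := odd_z_of_two_dvd_By hsol h2By
  -- sign of `z`: `z' ≡ -y·(B/4) (mod 4)`
  have ht : ¬ 2 ∣ -(y * ((B / 4 : ℕ) : ℤ)) := by
    intro h
    rw [dvd_neg] at h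
    rcases Int.prime_two.dvd_mul.mp h with h | h
    · exact hy h
    · exact hqodd h
  obtain ⟨z', hz'sgn, hz'⟩ := exists_sign_sub_four_dvd_int z _ hz ht
  have hsol' : IsPrimitiveSolution 1 B 1 n x y z' := hsol.of_sign hz'sgn
  have hzc : (4 : ℤ) ∣ z' + y * ((B / 4 : ℕ) : ℤ) := by
    have : z' + y * ((B / 4 : ℕ) : ℤ) = z' - -(y * ((B / 4 : ℕ) : ℤ)) := by ring
    rw [this]; exact hz'
  -- `y ≡ ∓ (B/4)·C (mod 4)` with `C = 1`: one of the two holds since `y` and `B/4` are odd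
  by_cases hsplit : (4 : ℤ) ∣ y + ((B / 4 : ℕ) : ℤ) * ((1 : ℕ) : ℤ)
  · have hcase : FreyCase.Holds .iii₁ 1 B 1 n x y z' := ⟨hxy, ⟨h4B, h8B⟩, hzc, hsplit⟩
    exact xno_solution_in_case M hP ⟨1, B, 1, n, x, y, z'⟩ .iii₁ N₁ one_pos hB one_pos squarefree_one hn h7
      (by simpa using hnB) (nthPowerFree_one B n (by omega) hfreeB) hsol' h1 h2 hcase hN₁ hD₁
      (famB B n P) ⟨Or.inl ⟨rfl, rfl, hPxy⟩, rfl, rfl⟩ hS₁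
  · have hsplit' : (4 : ℤ) ∣ y - ((B / 4 : ℕ) : ℤ) * ((1 : ℕ) : ℤ) := by
      push_cast at hsplit ⊢
      omega
    have hcase : FreyCase.Holds .iii₂ 1 B 1 n x y z' := ⟨hxy, ⟨h4B, h8B⟩, hzc, hsplit'⟩
    exact xno_solution_in_case M hP ⟨1, B, 1, n, x, y, z'⟩ .iii₂ N₂ one_pos hB one_pos squarefree_one hn h7
      (by simpa using hnB) (nthPowerFree_one B n (by omega) hfreeB) hsol' h1 h2 hcase hN₂ hD₂
      (famB B n P) ⟨Or.inl ⟨rfl, rfl, hPxy⟩, rfl, rfl⟩ hS₂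

/-- **Branch (i), `B` odd, `xy` odd:** case (i) for the datum or its swap (`case_i_or_swap`); both have level
`N = bs04Level i 1 B 1 n = bs04Level i B 1 1 n`. -/
theorem xbranch_i_odd (B : ℕ) (hB : 0 < B) (hBodd : ¬ 2 ∣ (B : ℤ)) (M : NewformModel) (hP : M.BS04Package)
    (n : ℕ) (hn : n.Prime) (h7 : 7 ≤ n) (hnB : ¬ n ∣ B) (hfreeB : ∀ q : ℕ, q.Prime → ¬ q ^ n ∣ B) (N : ℕ)
    (hN : bs04Level .i 1 B 1 n = N) (hN' : bs04Level .i B 1 1 n = N) (P : ℤ → ℤ → Prop) {orbs : List OrbitData}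
    (hD : M.DataComplete N orbs)
    (hS : ∀ o ∈ orbs, (∀ e ∈ o.coeffs, e.ell.Prime ∧ e.ell ≠ 2 ∧ ¬ e.ell ∣ N) ∧
      (o.Eliminated bs04Allowed n ∨ (M.Excludes N o (famB B n P) ∨ M.ExcludesStd N o n)))
    (x y z : ℤ) (hPxy : P x y) (hxy : ¬ 2 ∣ x * y) (hxy1 : x * y ≠ 1)
    (hxy2 : x * y ≠ -1) :
    ¬ IsPrimitiveSolution 1 B 1 n x y z := by
  intro hsol
  have hnodd : Odd n := hn.odd_of_ne_two (by omega)
  have hodd5 : ¬ 2 ∣ x * y * (1 : ℕ) * (B : ℕ) * (1 : ℕ) := by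
    intro h
    have h' : (2 : ℤ) ∣ x * y * B := by simpa using h
    rcases Int.prime_two.dvd_mul.mp h' with h2 | h2
    · exact hxy h2
    · exact hBodd h2
  have hfree1 := nthPowerFree_one B n (by omega) hfreeB
  rcases case_i_or_swap hsol hnodd hodd5 with hcase | hcase
  · exact xno_solution_in_case M hP ⟨1, B, 1, n, x, y, z⟩ .i N one_pos hB one_pos squarefree_one hn h7
      (by simpa using hnB) hfree1 hsol hxy1 hxy2 hcase hN hD
      (famB B n P) ⟨Or.inl ⟨rfl, rfl, hPxy⟩, rfl, rfl⟩ hS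
  · exact xno_solution_in_case M hP ⟨B, 1, 1, n, y, x, z⟩ .i N hB one_pos one_pos squarefree_one hn h7
      (by simpa using hnB) (fun q hq => ⟨(hfree1 q hq).2, (hfree1 q hq).1⟩) hsol.swap
      (by rw [mul_comm]; exact hxy1) (by rw [mul_comm]; exact hxy2) hcase hN' hD
      (famB B n P) ⟨Or.inr ⟨rfl, rfl, hPxy⟩, rfl, rfl⟩ hS

/-- **Branch `B` odd, `xy` even:** the even variable's term is put second (swap if `x` is even) and the datum is in
case (v₇) (`2ⁿ ∣ yⁿ`, `n ≥ 7`); level `N = bs04Level v₇ 1 B 1 n = bs04Level v₇ B 1 1 n`. -/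
theorem xbranch_even_Bodd (B : ℕ) (hB : 0 < B) (M : NewformModel) (hP : M.BS04Package)
    (n : ℕ) (hn : n.Prime) (h7 : 7 ≤ n) (hnB : ¬ n ∣ B) (hfreeB : ∀ q : ℕ, q.Prime → ¬ q ^ n ∣ B) (N : ℕ)
    (hN : bs04Level .v₇ 1 B 1 n = N) (hN' : bs04Level .v₇ B 1 1 n = N) (P : ℤ → ℤ → Prop) {orbs : List OrbitData}
    (hD : M.DataComplete N orbs)
    (hS : ∀ o ∈ orbs, (∀ e ∈ o.coeffs, e.ell.Prime ∧ e.ell ≠ 2 ∧ ¬ e.ell ∣ N) ∧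
      (o.Eliminated bs04Allowed n ∨ (M.Excludes N o (famB B n P) ∨ M.ExcludesStd N o n)))
    (x y z : ℤ) (hPxy : P x y) (hxy : 2 ∣ x * y) :
    ¬ IsPrimitiveSolution 1 B 1 n x y z := by
  intro hsol
  obtain ⟨hxy1, hxy2⟩ := ne_pm_one_of_even hxy
  have hfree1 := nthPowerFree_one B n (by omega) hfreeB
  rcases Int.prime_two.dvd_mul.mp hxy with hx | hy
  · -- `x` even: swap, datum `(B, 1; y, x)`
    have hv : (2 : ℤ) ^ 7 ∣ (1 : ℕ) * x ^ n := by
      simpa using (pow_dvd_pow 2 h7).trans (pow_dvd_pow_of_dvd hx n)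
    have hz : ¬ 2 ∣ z := by
      intro hz
      obtain ⟨-, -, -, -, -, hac, -⟩ := hsol
      have hu := hac.isUnit_of_dvd' (by simpa using hx) (by simpa using hz)
      rcases Int.isUnit_iff.mp hu with h | h <;> omega
    obtain ⟨z', hz'sgn, hz'⟩ := exists_sign_sub_four_dvd_int z 1 hz (by omega)
    have hsol' : IsPrimitiveSolution B 1 1 n y x z' := (hsol.of_sign hz'sgn).swap
    have hcase : FreyCase.Holds .v₇ B 1 1 n y x z' := ⟨hv, by simpa using hz'⟩
    exact xno_solution_in_case M hP ⟨B, 1, 1, n, y, x, z'⟩ .v₇ N hB one_pos one_pos squarefree_one hn h7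
      (by simpa using hnB) (fun q hq => ⟨(hfree1 q hq).2, (hfree1 q hq).1⟩) hsol'
      (by rw [mul_comm]; exact hxy1) (by rw [mul_comm]; exact hxy2) hcase hN' hD
      (famB B n P) ⟨Or.inr ⟨rfl, rfl, hPxy⟩, rfl, rfl⟩ hS
  · -- `y` even
    have hv : (2 : ℤ) ^ 7 ∣ (B : ℤ) * y ^ n :=
      Dvd.dvd.mul_left ((pow_dvd_pow 2 h7).trans (pow_dvd_pow_of_dvd hy n)) _
    exact xbranch_v7 B hB M hP n hn h7 hnB hfreeB N hN P hD hS x y z hPxy hv hxy1 hxy2 hsol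


/-! ## Arithmetic of `B = 2^a · ℓ^m` (census line C2a) -/

end Summit.Ventures.AbcSig
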